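import Summits.CriticalPhenomena.CardyFormulaZ2.Theorems.CardyComplexConeEdgePrecompactPassageAgree
import Literature.Probability.LatticeModels.MeshDomainJordan

/-!
# Hull stability from response stability
(line `qkz-strip-boundary-arm` of crux `CardyComplexCone.EdgePrecompact`, stmt-CriticalPhenomena-11387)

The landed reduction `shiftCouplingLocality_of_hullStability`
(`Theorems/CardyComplexConeEdgePrecompactShiftCouplingLocalityReduction.lean`) derives the stub
`stub_shiftCouplingLocality` (X2) from HULL STABILITY: eventually in `δ`, uniformly over corners
`δv ∈ K` and shifts `‖δw‖ < η`, the event "some filling of the ball `B(δv, ρ)` makes the explorations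
of `Λ δ` and of its translate `shiftData (Λ δ) w` traverse the dart `(v,f)` with different sets of
prefix windings" has probability `≤ ε`. This file removes the filling: by the pointwise theorem
`passageAgree_of_response` (`…EdgePrecompactPassageAgree.lean`, on top of the synchronisation
theorem `passageSync`), that event is contained in the purely EXTERIOR event "the two dynamics do not
respond alike" — some initial stretch (from the marked edges `e_a`, `e_a + w`) or some exterior stretch
from an exit corner of the ball re-enters the ball at a different corner, or with a different
accumulated turning, or leaves the inner faces — whose complement is read off the configuration OFF
the ball (`response_transfer`: a stretch reads only the edges it arrives at, all outside the ball).
Hence RESPONSE STABILITY ⟹ HULL STABILITY (registered sub-goal `hullStability_of_responseStability`):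

* RESPONSE STABILITY (the hypothesis, inline; the remaining, purely probabilistic input of X2): with
  the quantifier prefix of X2, `P_{1/2}(responses differ) ≤ ε`. Its expected proof is the planner's
  step (c): a differing response forces the stretch to reach the `η`-collar of `∂D` where the two
  data differ and to be affected there — boundary three-arm events summed over the collar (exponent
  `1 + α > 1` on `ℤ²`, `Z2HalfPlane.real_threeArm_le`) and marked-point re-rooting (half-plane
  two-arm) —, i.e. RSW/arm estimates in Jordan domains; NOT proved here.
* The geometric input of `passageAgree_of_response` — both discrete domains contain every lattice
  edge near the ball — holds eventually in `δ` by the bulk theorem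
  `JordanDomain.eventually_forall_mem_meshDomain'` (`MeshDomainJordan.lean`) applied to the compact
  `cthickening (3ρ/2) K ⊂ D`, for `η ≤ ρ/4` and `δ < ρ/56`.

In this file `Polyline.winding` is written qualified (both copies of the polyline winding are in the
cone); it is the constant denoted `winding` in the reduction file, so the conclusion below is
literally the hypothesis of `shiftCouplingLocality_of_hullStability`.

References: S. Smirnov, C. R. Acad. Sci. Paris 333 (2001), §2; G. F. Lawler, O. Schramm, W. Werner,
Electron. J. Probab. 7 (2002), Appendix A (half-plane arm estimates); G. Grimmett, *Percolation*
(1999), §11.2.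
-/

namespace Summit.CriticalPhenomena.CardyFormulaZ2.Cruxes.EdgePrecompact.QkzStripBoundaryArm

open MeasureTheory Filter Set Metric
open scoped Topology BigOperators Pointwise
open Literature.Probability.LatticeModels Literature.Probability.Percolation
open Literature.Probability.RandomPlanarGeometry (DobrushinDomain)
open Summit.CriticalPhenomena.CardyFormulaZ2.Theses.CardyComplexCone

noncomputable section

/-! ## Responses are read off the exterior configuration -/

/-- Configurations agreeing off `I` complete to configurations agreeing off `I`. -/
theorem bcBondConfig_agree_off {E : DiscreteDobrushin} {ω ω' : BondConfig (Site 2)}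
    {I : Set (Sym2 (Site 2))} (h : ω' \ I = ω \ I) :
    ∀ e ∉ I, (e ∈ E.bcBondConfig ω ↔ e ∈ E.bcBondConfig ω') := by
  intro e he
  have hωω' : e ∈ ω ↔ e ∈ ω' := by
    have := Set.ext_iff.1 h e
    simp only [Set.mem_sdiff] at this
    tauto
  simp only [DiscreteDobrushin.mem_bcBondConfig_iff, hωω']

/-- A stretch of orbit whose target edges stay off `I` is the same for two configurations agreeing
off `I` (the successor reads only the target edge). -/
theorem cornerOrbit_eq_of_agree_off {β β' : BondConfig (Site 2)} {I : Set (Sym2 (Site 2))}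
    (h : ∀ e ∉ I, (e ∈ β ↔ e ∈ β')) (q : Site 2 × Fin 4) {n : ℕ}
    (hpre : ∀ i < n, cTgt (cornerOrbit β q i) ∉ I) :
    ∀ i ≤ n, cornerOrbit β' q i = cornerOrbit β q i := by
  intro i hi
  induction i with
  | zero => rfl
  | succ i ih =>
    have ih' := ih (by omega)
    show nextCorner β' (cornerOrbit β' q i) = nextCorner β (cornerOrbit β q i)
    rw [ih']
    have hagree := h _ (hpre i (by omega))
    by_cases hm : cTgt (cornerOrbit β q i) ∈ β
    · rw [nextCorner_of_mem hm, nextCorner_of_mem (hagree.1 hm)]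
    · rw [nextCorner_of_not_mem hm, nextCorner_of_not_mem fun h' => hm (hagree.2 h')]

/-- … and so is its accumulated turning. -/
theorem sum_turnOf_eq_of_agree_off {β β' : BondConfig (Site 2)} {I : Set (Sym2 (Site 2))}
    (h : ∀ e ∉ I, (e ∈ β ↔ e ∈ β')) (q : Site 2 × Fin 4) {n : ℕ}
    (hpre : ∀ i < n, cTgt (cornerOrbit β q i) ∉ I) :
    ∑ i ∈ Finset.range n, turnOf β' (cornerOrbit β' q i) =
      ∑ i ∈ Finset.range n, turnOf β (cornerOrbit β q i) := by
  refine Finset.sum_congr rfl fun i hi => ?_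
  rw [Finset.mem_range] at hi
  rw [cornerOrbit_eq_of_agree_off h q hpre i hi.le]
  have hagree := h _ (hpre i hi)
  by_cases hm : cTgt (cornerOrbit β q i) ∈ β
  · simp [turnOf, hm, hagree.1 hm]
  · have hm' : cTgt (cornerOrbit β q i) ∉ β' := fun h' => hm (hagree.2 h')
    simp [turnOf, hm, hm']

/-- **Exterior determinacy of a response.** The response statement "whenever the `β₀`-orbit of `c₀`
first enters `I` through inner faces, the `β₁`-orbit of `c₁` first enters `I` through inner faces
at the same corner with the same turning" transfers from `(β₀, β₁)` to any `(β₀', β₁')` agreeing with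
them off `I`. -/
theorem response_transfer {β₀ β₀' β₁ β₁' : BondConfig (Site 2)} {I : Set (Sym2 (Site 2))}
    (h₀ : ∀ e ∉ I, (e ∈ β₀ ↔ e ∈ β₀')) (h₁ : ∀ e ∉ I, (e ∈ β₁ ↔ e ∈ β₁'))
    (In₀ In₁ : Site 2 → Prop) (c₀ c₁ : Site 2 × Fin 4)
    (H : ∀ n : ℕ, (∀ i < n, cTgt (cornerOrbit β₀ c₀ i) ∉ I ∧ In₀ (cFace (cornerOrbit β₀ c₀ (i + 1)))) →
      cTgt (cornerOrbit β₀ c₀ n) ∈ I → ∃ n' : ℕ,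
        (∀ i < n', cTgt (cornerOrbit β₁ c₁ i) ∉ I ∧ In₁ (cFace (cornerOrbit β₁ c₁ (i + 1)))) ∧
        cornerOrbit β₁ c₁ n' = cornerOrbit β₀ c₀ n ∧
        ∑ i ∈ Finset.range n', turnOf β₁ (cornerOrbit β₁ c₁ i) =
          ∑ i ∈ Finset.range n, turnOf β₀ (cornerOrbit β₀ c₀ i)) :
    ∀ n : ℕ, (∀ i < n, cTgt (cornerOrbit β₀' c₀ i) ∉ I ∧ In₀ (cFace (cornerOrbit β₀' c₀ (i + 1)))) →
      cTgt (cornerOrbit β₀' c₀ n) ∈ I → ∃ n' : ℕ,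
        (∀ i < n', cTgt (cornerOrbit β₁' c₁ i) ∉ I ∧ In₁ (cFace (cornerOrbit β₁' c₁ (i + 1)))) ∧
        cornerOrbit β₁' c₁ n' = cornerOrbit β₀' c₀ n ∧
        ∑ i ∈ Finset.range n', turnOf β₁' (cornerOrbit β₁' c₁ i) =
          ∑ i ∈ Finset.range n, turnOf β₀' (cornerOrbit β₀' c₀ i) := by
  intro n hpre' hentry'
  have h₀' : ∀ e ∉ I, (e ∈ β₀' ↔ e ∈ β₀) := fun e he => (h₀ e he).symm
  have horb₀ : ∀ i ≤ n, cornerOrbit β₀ c₀ i = cornerOrbit β₀' c₀ i :=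
    cornerOrbit_eq_of_agree_off h₀' c₀ fun i hi => (hpre' i hi).1
  have hpre : ∀ i < n, cTgt (cornerOrbit β₀ c₀ i) ∉ I ∧ In₀ (cFace (cornerOrbit β₀ c₀ (i + 1))) :=
    fun i hi => by
      rw [horb₀ i hi.le, horb₀ (i + 1) hi]
      exact hpre' i hi
  have hentry : cTgt (cornerOrbit β₀ c₀ n) ∈ I := by
    rw [horb₀ n le_rfl]
    exact hentry'
  obtain ⟨n', hstr, hcorner, hsum⟩ := H n hpre hentry
  have horb₁ : ∀ i ≤ n', cornerOrbit β₁' c₁ i = cornerOrbit β₁ c₁ i :=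
    cornerOrbit_eq_of_agree_off h₁ c₁ fun i hi => (hstr i hi).1
  refine ⟨n', fun i hi => ?_, ?_, ?_⟩
  · rw [horb₁ i hi.le, horb₁ (i + 1) hi]
    exact hstr i hi
  · rw [horb₁ n' le_rfl, hcorner, horb₀ n le_rfl]
  · rw [sum_turnOf_eq_of_agree_off h₁ c₁ fun i hi => (hstr i hi).1, hsum,
      sum_turnOf_eq_of_agree_off h₀' c₀ fun i hi => (hpre' i hi).1]

/-! ## The reduction -/

/-- **Hull stability from response stability** (registered sub-goal `hullStability_of_responseStability`
of stmt-CriticalPhenomena-11387). HYPOTHESIS (RESPONSE STABILITY, inline): along a discretisation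
family `Λ` of `D`, on a compact `K` with `cthickening (2ρ) K ⊆ D`, for every `ε > 0` there is `η > 0`
such that eventually in `δ`, for every corner `(v,f)` with `δv ∈ K` and every `w` with `‖δw‖ < η`, the
event "the dynamics of `Λ δ` and of `shiftData (Λ δ) w` in `ω` do not respond alike — for some pair
of corners `(a, a')` which is either the pair of start corners or a diagonal pair `(q, q)` at an exit
corner `q` of the ball `B(δv, ρ)`, in one of the two directions, the stretch of the first orbit
re-enters the ball through inner faces but the stretch of the second does not re-enter at the same
corner through inner faces with the same turning sum" has `P_{1/2}`-probability `≤ ε`. CONCLUSION: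
the hull-stability hypothesis of `shiftCouplingLocality_of_hullStability`, verbatim. -/
theorem hullStability_of_responseStability : (∀ (D : DobrushinDomain) (Λ : ℝ → DiscreteDobrushin), (∀ δ, (Λ δ).Ω = D.carrier) → (∀ δ, (Λ δ).δ = δ) → (∀ᶠ δ in nhdsWithin (0:ℝ) (Set.Ioi 0), (Λ δ).IsZdAdmissible) → ∀ K : Set ℂ, IsCompact K → K ⊆ D.carrier → ∀ ρ > (0:ℝ), cthickening (2 * ρ) K ⊆ D.carrier → ∀ ε > (0:ℝ), ∃ η > (0:ℝ), ∀ᶠ δ in nhdsWithin (0:ℝ) (Set.Ioi 0), ∀ v f w : Site 2, IsCorner v f → meshPoint δ v ∈ K → ‖meshPoint δ w‖ < η → (bondPercolation (zdGraph 2) half).real {ω : BondConfig (Site 2) | ¬ ∀ a a' : Site 2 × Fin 4, (((Λ δ).IsStartCorner a ∧ (shiftData (Λ δ) w).IsStartCorner a') ∨ (a = a' ∧ medialPoint δ (cSrc a) ∈ ball (meshPoint δ v) ρ ∧ medialPoint δ (cTgt a) ∉ ball (meshPoint δ v) ρ)) → (∀ n : ℕ, (∀ i < n, medialPoint δ (cTgt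 (cornerOrbit ((Λ δ).bcBondConfig ω) a i)) ∉ ball (meshPoint δ v) ρ ∧ (Λ δ).IsInnerFace (cFace (cornerOrbit ((Λ δ).bcBondConfig ω) a (i + 1)))) → medialPoint δ (cTgt (cornerOrbit ((Λ δ).bcBondConfig ω) a n)) ∈ ball (meshPoint δ v) ρ → ∃ n' : ℕ, (∀ i < n', medialPoint δ (cTgt (cornerOrbit ((shiftData (Λ δ) w).bcBondConfig ω) a' i)) ∉ ball (meshPoint δ v) ρ ∧ (shiftData (Λ δ) w).IsInnerFace (cFace (cornerOrbit ((shiftData (Λ δ) w).bcBondConfig ω) a' (i + 1)))) ∧ cornerOrbit ((shiftData (Λ δ) w).bcBondConfig ω) a' n' = cornerOrbit ((Λ δ).bcBondConfig ω) a n ∧ ∑ i ∈ Finset.range n', turnOf ((shiftData (Λ δ) w).bcBondConfig ω) (cornerOrbit ((shiftData (Λ δ) w).bcBondConfig ω) a' i) = ∑ i ∈ Finset.range n, turnOf ((Λ δ).bcBondConfig ω) (cornerOrbit ((Λ δ).bcBondConfig ω) a i)) ∧ (∀ n : ℕ, (∀ i < n, medialPoint δ (cTgt (cornerOrbit ((shiftData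 (Λ δ) w).bcBondConfig ω) a' i)) ∉ ball (meshPoint δ v) ρ ∧ (shiftData (Λ δ) w).IsInnerFace (cFace (cornerOrbit ((shiftData (Λ δ) w).bcBondConfig ω) a' (i + 1)))) → medialPoint δ (cTgt (cornerOrbit ((shiftData (Λ δ) w).bcBondConfig ω) a' n)) ∈ ball (meshPoint δ v) ρ → ∃ n' : ℕ, (∀ i < n', medialPoint δ (cTgt (cornerOrbit ((Λ δ).bcBondConfig ω) a i)) ∉ ball (meshPoint δ v) ρ ∧ (Λ δ).IsInnerFace (cFace (cornerOrbit ((Λ δ).bcBondConfig ω) a (i + 1)))) ∧ cornerOrbit ((Λ δ).bcBondConfig ω) a n' = cornerOrbit ((shiftData (Λ δ) w).bcBondConfig ω) a' n ∧ ∑ i ∈ Finset.range n', turnOf ((Λ δ).bcBondConfig ω) (cornerOrbit ((Λ δ).bcBondConfig ω) a i) = ∑ i ∈ Finset.range n, turnOf ((shiftData (Λ δ) w).bcBondConfig ω) (cornerOrbit ((shiftData (Λ δ) w).bcBondConfig ω) a' i))} ≤ ε) → ∀ (D : DobrushinDomain) (Λ : ℝ → DiscreteDobrushin), (∀ δ,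 (Λ δ).Ω = D.carrier) → (∀ δ, (Λ δ).δ = δ) → (∀ᶠ δ in nhdsWithin (0:ℝ) (Set.Ioi 0), (Λ δ).IsZdAdmissible) → ∀ K : Set ℂ, IsCompact K → K ⊆ D.carrier → ∀ ρ > (0:ℝ), cthickening (2 * ρ) K ⊆ D.carrier → ∀ ε > (0:ℝ), ∃ η > (0:ℝ), ∀ᶠ δ in nhdsWithin (0:ℝ) (Set.Ioi 0), ∀ v f w : Site 2, IsCorner v f → meshPoint δ v ∈ K → ‖meshPoint δ w‖ < η → (bondPercolation (zdGraph 2) half).real {ω : BondConfig (Site 2) | ∃ ω' : BondConfig (Site 2), ω' \ {e | medialPoint δ e ∈ ball (meshPoint δ v) ρ} = ω \ {e | medialPoint δ e ∈ ball (meshPoint δ v) ρ} ∧ ¬ ∀ W : ℝ, (∃ k : ℕ, (medialExploration (Λ δ) ω')[k]? = some (cornerSource v f) ∧ (medialExploration (Λ δ) ω')[k + 1]? = some (cornerTarget v f) ∧ Polyline.winding (((medialExploration (Λ δ) ω').map (medialPoint δ)).take (k + 2)) = W) ↔ (∃ k : ℕ, (medialExploration (shiftData (Λ δ) w) ω')[k]?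 = some (cornerSource v f) ∧ (medialExploration (shiftData (Λ δ) w) ω')[k + 1]? = some (cornerTarget v f) ∧ Polyline.winding (((medialExploration (shiftData (Λ δ) w) ω').map (medialPoint δ)).take (k + 2)) = W)} ≤ ε := by
  intro hRS D Λ hΩ hδ hadm K hK hKD ρ hρ hρK ε hε
  obtain ⟨η, hη, hev⟩ := hRS D Λ hΩ hδ hadm K hK hKD ρ hρ hρK ε hε
  refine ⟨min η (ρ / 4), lt_min hη (by positivity), ?_⟩
  -- the bulk of `D`: eventually every lattice point of `cthickening (3ρ/2) K` lies in `Ω_δ`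
  have hK' : IsCompact (cthickening (3 * ρ / 2) K) := hK.cthickening
  have hK'D : cthickening (3 * ρ / 2) K ⊆ D.carrier :=
    (cthickening_mono (by linarith) K).trans hρK
  have hbulk := D.toJordanDomain.eventually_forall_mem_meshDomain' hK' hK'D
  have hsmall : ∀ᶠ δ in 𝓝[>] (0:ℝ), δ < ρ / 56 :=
    (eventually_lt_nhds (by positivity)).filter_mono nhdsWithin_le_nhds
  have hpos : ∀ᶠ δ in 𝓝[>] (0:ℝ), 0 < δ := eventually_mem_nhdsWithin
  filter_upwards [hev, hadm, hbulk, hsmall, hpos] with δ hevδ hadmδ hbulkδ hδs hδp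
  intro v f w hvf hvK hw
  have hwη : ‖meshPoint δ w‖ < η := lt_of_lt_of_le hw (min_le_left _ _)
  have hwρ : ‖meshPoint δ w‖ < ρ / 4 := lt_of_lt_of_le hw (min_le_right _ _)
  have hΛδ : (Λ δ).δ = δ := hδ δ
  -- every lattice edge at a site within `ρ + ρ/4 + 10δ` of `δv` is an edge of `Ω_δ`
  have hM : ∀ x y : Site 2, dist (meshPoint δ x) (meshPoint δ v) < ρ + ρ / 4 + 10 * δ →
      (zdGraph 2).Adj x y → (discreteDomainGraph D.carrier δ).Adj x y := by
    intro x y hx hxy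
    obtain ⟨k, rfl⟩ := exists_eq_add_cornerUnit hxy
    have hy : dist (meshPoint δ (x + cornerUnit k)) (meshPoint δ v) < ρ + ρ / 4 + 14 * δ := by
      have h1 := dist_meshPoint_add_cornerUnit_le hδp.le x k
      have h2 := dist_triangle (meshPoint δ (x + cornerUnit k)) (meshPoint δ x) (meshPoint δ v)
      linarith
    have hin : ∀ u : Site 2, dist (meshPoint δ u) (meshPoint δ v) < ρ + ρ / 4 + 14 * δ →
        u ∈ meshDomain D.carrier δ := fun u hu =>
      hbulkδ.1 u (mem_cthickening_of_dist_le _ _ _ K hvK (by linarith))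
    have hball : ∀ u : Site 2, dist (meshPoint δ u) (meshPoint δ v) < ρ + ρ / 4 + 14 * δ →
        meshPoint δ u ∈ closedBall (meshPoint δ v) (ρ + ρ / 4 + 14 * δ) := fun u hu =>
      mem_closedBall.2 hu.le
    rw [discreteDomainGraph_adj_iff, meshGraph_adj_iff]
    refine ⟨⟨hxy, ?_⟩, hin x (by linarith), hin _ hy⟩
    refine ((convex_closedBall _ _).segment_subset (hball x (by linarith)) (hball _ hy)).trans ?_
    refine Set.Subset.trans (fun u hu => ?_) subset_closure
    exact hρK (mem_cthickening_of_dist_le u (meshPoint δ v) (2 * ρ) K hvK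
      (by have := mem_closedBall.1 hu; linarith))
  -- depth of the two data around the ball
  have hdeep₀ : ∀ x y : Site 2, dist (meshPoint δ x) (meshPoint δ v) < ρ + 10 * δ →
      (zdGraph 2).Adj x y → (discreteDomainGraph (Λ δ).Ω (Λ δ).δ).Adj x y := fun x y hx hxy => by
    rw [hΩ, hΛδ]
    exact hM x y (by linarith) hxy
  have hdeep₁ : ∀ x y : Site 2, dist (meshPoint δ x) (meshPoint δ v) < ρ + 10 * δ →
      (zdGraph 2).Adj x y →
      (discreteDomainGraph (shiftData (Λ δ) w).Ω (shiftData (Λ δ) w).δ).Adj x y := by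
    intro x y hx hxy
    have key : (discreteDomainGraph (Λ δ).Ω (Λ δ).δ).Adj (x - w) (y - w) := by
      rw [hΩ, hΛδ]
      refine hM _ _ ?_ ((zdGraph_adj_shift_iff w (x - w) (y - w)).1 (by simpa only [Site.shift_apply, sub_add_cancel] using hxy))
      have hsub : meshPoint δ (x - w) = meshPoint δ x - meshPoint δ w :=
        eq_sub_of_add_eq (by rw [add_comm, ← meshPoint_add_shift, sub_add_cancel])
      rw [hsub]
      calc dist (meshPoint δ x - meshPoint δ w) (meshPoint δ v)
          ≤ dist (meshPoint δ x - meshPoint δ w) (meshPoint δ x) + dist (meshPoint δ x) (meshPoint δ v) :=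
            dist_triangle _ _ _
        _ = ‖meshPoint δ w‖ + dist (meshPoint δ x) (meshPoint δ v) := by
            rw [dist_eq_norm]; congr 1; simp
        _ < ρ + ρ / 4 + 10 * δ := by linarith
    have := (adj_shiftData_iff (Λ δ) w (x - w) (y - w)).2 key
    simpa only [sub_add_cancel] using this
  -- the event of hull stability is contained in "responses differ"
  refine le_trans (measureReal_mono ?_) (hevδ v f w hvf hvK hwη)
  rintro ω ⟨ω', hωω', hdis⟩ hgood
  apply hdis
  obtain ⟨j, rfl⟩ := exists_faceAt_of_isCorner hvf
  rw [show cornerSource v (faceAt v j) = cSrc (v, j) from cornerSource_cFace (v, j),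
    show cornerTarget v (faceAt v j) = cTgt (v, j) from cornerTarget_cFace (v, j)]
  have hδρ : δ < ρ := by linarith
  have hps : medialPoint δ (cSrc (v, j)) ∈ ball (meshPoint δ v) ρ :=
    mem_ball.2 (lt_of_le_of_lt (dist_medialPoint_cSrc_le' hδp.le (v, j)) hδρ)
  have hpt : medialPoint δ (cTgt (v, j)) ∈ ball (meshPoint δ v) ρ :=
    mem_ball.2 (lt_of_le_of_lt (dist_medialPoint_cTgt_le' hδp.le (v, j)) hδρ)
  have h₀ := bcBondConfig_agree_off (E := Λ δ) hωω'
  have h₁ := bcBondConfig_agree_off (E := shiftData (Λ δ) w) hωω'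
  exact passageAgree_of_response (Λ δ) (shiftData (Λ δ) w) δ (meshPoint δ v) ρ (ρ + 10 * δ) hadmδ
    (isZdAdmissible_shiftData _ _ hadmδ) hΛδ hΛδ le_rfl hdeep₀ hdeep₁ ω' (v, j) hps hpt
    (fun c₀ c₁ hc₀ hc₁ => ⟨response_transfer h₀ h₁ _ _ c₀ c₁ (hgood c₀ c₁ (Or.inl ⟨hc₀, hc₁⟩)).1,
      response_transfer h₁ h₀ _ _ c₁ c₀ (hgood c₀ c₁ (Or.inl ⟨hc₀, hc₁⟩)).2⟩)
    (fun q hq hq' => ⟨response_transfer h₀ h₁ _ _ q q (hgood q q (Or.inr ⟨rfl, hq, hq'⟩)).1,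
      response_transfer h₁ h₀ _ _ q q (hgood q q (Or.inr ⟨rfl, hq, hq'⟩)).2⟩)

end

end Summit.CriticalPhenomena.CardyFormulaZ2.Cruxes.EdgePrecompact.QkzStripBoundaryArm
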